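import Summits.QuantumFields.BalabanUV.Beta.GAN24.FaceWordNullSector
import Summits.QuantumFields.BalabanUV.Beta.GAN24.FaceWordVHNullCurrents
import Summits.QuantumFields.BalabanUV.Beta.GAN24.FaceWordEEZero
import Summits.QuantumFields.BalabanUV.Beta.SpineRecursiveW

/-!
# `BalabanUV.Beta.GAN24.FaceWordFullZero` — binder row G-an2-4 ∕ (CONV-C), W-slot (α-0), typer's PART VI row **T6-VAL**, the (γ) hand's letter **K7-0 WITH THE SECTOR SPLIT (α) DONE**:
# **leaf-02 Part 45's OUTPUT WORD FOR road-P2's FULL UNIT-SCALED LEVEL-`0` FINE TABLE `S♮_0 = unitS sf sm (SpureRecAt d Lc ρ cE cVH cΛ 0)` — E AND VH SECTORS TOGETHER — THROUGH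
# `X̃♮_0` AT THE DEEP PERIOD `Lc·N`, VALUED**: it equals the E-sector value of `FaceWordEEZero.faceWordEE_zero_value` (`μ ≠ α`, `ν ≠ β`; every `d`, in-block root, `Lc, N ≥ 1`, all units and
# colour constants) — the VH sector's two-face currents are null (`FaceWordVHNullCurrents`, from this lineage's `FaceDataVHNull`), so by the generalised junction
# `FaceWordNullSector.faceWord_eq_cellPairing_of_null` no E⊗VH ∕ VH⊗E ∕ VH⊗VH word is ever formed
# (G-an2-4 CRUX TEAM (2), seat `b2b-balaban-gan24-formalise-leaf-06` = the (γ) hand, gen 57; journal [GAN24LEAF06-G57-INTENT-5])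

NOT IN PRINT; OUR BOOKKEEPING ([folklore] bookkeeping BY NAME: an2's `SpineRecursiveW.SpureRecAt_zero_level ∕ SpureRecAt_translate`, `StepJetData.locStencil_wilsonA ∕ locStencil_smul ∕
locStencil_add`, an1's `AveragingHessianKernelsRooted.locStencil_vhSAt`, `HessKerDressedUnits.unitS_apply ∕ locStencil_unitS ∕ decays_unitK`, `AxialDressingRooted.decays_coDressKBmAt_KInvStep`;
this seat's (K) `FaceWordNullSector`, (L) `FaceWordVHNullCurrents`, (H) `FaceWordEEZero`, (E) `FaceWordEEValueZero`; 0 `def`, 0 cited fact, 0 `def … : Prop`, 0 sorry).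
HONEST FRAMING (cell contract, verbatim): «discharging `BetaPertH` makes Bałaban's UV stability UNCONDITIONAL — a real constructive-QFT result; it is NOT the continuum
limit and NOT the Clay problem.»  HONEST DEPENDENCY (verbatim): «continuum YM on T⁴ ⇐ BetaPertH ∧ nine spine estimates (0/9 proved); BetaPertH ⇐ (D1) ∧ (D4) ∧ CAP+tail;
G-an2-4 gates asym, D1 and NE2/3/4.»

WHAT ([folklore]): §1 `fullTable0_split` (`S♮_0 = S^E_0 + S^VH_0` slotwise, through the units), `fullTable0_translate` (`Lc·N`-covariance), `exists_common_rate_full0` (`S♮_0`, `S^E_0`, `S^VH_0`, `X̃♮_0`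
at ONE rate); §2 **`faceWordFull_zero_value`**.  The W word of Part 47 and the `LS`∕`FFsym` pattern sum remain the adapter's; asserts NO value of Bałaban's tables beyond this identity;
discharges NOTHING of `hX` ∕ `hXu` ∕ (C)_{≥1} ∕ `hB0` ∕ `hBF` ∕ (Q-L); NEVER «G-an2-4 closed» as (CONV-C); NOT D1, NOT `BetaPertH`, NOT continuum, NOT Clay.  2026-08-24; no existing file touched.
-/

noncomputable section

open Finset
open scoped BigOperators
open Literature.MathematicalPhysics.QuantumFieldTheory
open Literature.MathematicalPhysics.QuantumFieldTheory.Balaban1983to89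
open Literature.MathematicalPhysics.QuantumFieldTheory.Balaban1983to89.Beta
open ExpKernelCalculus (Site MKer Decays BiLoc shiftK comp)
open OneStepResolventKernel (Fib LocStencil decays_mono)
open OneStepKernelFamily (KInvStep)
open BalabanStepJets (locStencil_mono)
open StepJetData (wilsonA locStencil_wilsonA wilsonA_translate locStencil_smul locStencil_add)
open AffineAveraging (box toSite)
open AveragingHessianKernelsRooted (vhSAt locStencil_vhSAt vhSAt_translate)
open BalabanStepJetsSucc (E2 wVH)
open Summit.QuantumFields.BalabanUV.Beta.AxialDressingRooted (coDressKBmAt one_le_of_neZero decays_coDressKBmAt_KInvStep)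
open Summit.QuantumFields.BalabanUV.Beta.HessKerDressedUnits (unitK unitS unitS_apply locStencil_unitS decays_unitK)
open Summit.QuantumFields.BalabanUV.Beta.SpineRooted (SpureRecAt SpureRecAt_zero_level SpureRecAt_translate)
open Summit.QuantumFields.BalabanUV.Beta.GAN24.FaceWordNullSector (faceWord_eq_cellPairing_of_null)
open Summit.QuantumFields.BalabanUV.Beta.GAN24.FaceWordVHNullCurrents (vhSector_nullL vhSector_nullR)
open Summit.QuantumFields.BalabanUV.Beta.GAN24.FaceWordEEZero (sectorE0_inr_left sectorE0_inr_right dressedStep_invariant_deep0)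
open Summit.QuantumFields.BalabanUV.Beta.GAN24.FaceWordEEValueZero (cellPairing_zero_value_units)

namespace Summit.QuantumFields.BalabanUV.Beta.GAN24.FaceWordFullZero

variable {d : ℕ} {Lc : ℕ} [NeZero Lc] {r : Fin (d + 1) → ℕ}

/-! ## §1 The level-`0` fine table splits into its E and VH sectors through the units; covariance; one common rate -/

/-- [folklore] **`S♮_0 = S^E_0 + S^VH_0` SLOTWISE** (`SpureRecAt_zero_level` through the linear units `unitS_apply`). -/
theorem fullTable0_split (sf sm cE cVH cΛ : ℝ) (κ : Fin (d + 1)) (t : Site (d + 1)) :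
    unitS sf sm (SpureRecAt d Lc (toSite r) cE cVH cΛ 0) κ t = unitS sf sm (fun κ u => cE • wilsonA d κ u) κ t + unitS sf sm (fun κ u => cVH • vhSAt (toSite r) d Lc rfl κ u) κ t := by
  funext x z a b
  simp only [Pi.add_apply, unitS_apply, SpureRecAt_zero_level, Pi.smul_apply, smul_eq_mul]
  ring

/-- [folklore] **`Lc•t`-COVARIANCE OF THE UNIT-SCALED LEVEL-`0` TABLE** (`SpureRecAt_translate` at `j = 0` through the units). -/
theorem fullTable0_translate (sf sm cE cVH cΛ : ℝ) (κ : Fin (d + 1)) (u t : Site (d + 1)) :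
    unitS sf sm (SpureRecAt d Lc (toSite r) cE cVH cΛ 0) κ (u + (Lc : ℤ) • t) = shiftK (-((Lc : ℤ) • t)) (unitS sf sm (SpureRecAt d Lc (toSite r) cE cVH cΛ 0) κ u) := by
  have hLc : 1 ≤ Lc := one_le_of_neZero Lc
  have h := SpureRecAt_translate (d := d) (toSite r) hLc cE cVH cΛ 0 κ u t
  funext x z a b
  have hxz := congrFun (congrFun (congrFun (congrFun h x) z) a) b
  simp only [unitS_apply, shiftK] at hxz ⊢
  rw [hxz]

/-- [folklore] **ONE COMMON RATE** for `S♮_0`, `S^E_0`, `S^VH_0` (local stencil families at EVERY rate) and the decaying `X̃♮_0`. -/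
theorem exists_common_rate_full0 (hr : r ∈ box (d + 1) Lc) (sf sm cE cVH cΛ : ℝ) :
    ∃ Cs Cs₁ Cs₂ CX m : ℝ, 0 < m ∧ LocStencil (unitS sf sm (SpureRecAt d Lc (toSite r) cE cVH cΛ 0)) Cs m ∧ LocStencil (unitS sf sm (fun κ u => cE • wilsonA d κ u)) Cs₁ m ∧ LocStencil (unitS sf sm (fun κ u => cVH • vhSAt (toSite r) d Lc rfl κ u)) Cs₂ m ∧
      Decays (unitK sf sm (coDressKBmAt (toSite r) Lc (KInvStep (d := d) Lc 0))) CX m := by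
  have hLc : 1 ≤ Lc := one_le_of_neZero Lc
  obtain ⟨δK, CK, hδK, -, hXd⟩ := decays_coDressKBmAt_KInvStep (d := d) hr 0
  have hW := locStencil_wilsonA (d := d) hδK.le
  have hV := locStencil_vhSAt (d := d) hLc hr hδK.le
  have hE := locStencil_unitS (sf := sf) (sm := sm) (locStencil_smul cE hW)
  have hVH := locStencil_unitS (sf := sf) (sm := sm) (locStencil_smul cVH hV)
  have hS0 : LocStencil (SpureRecAt d Lc (toSite r) cE cVH cΛ 0) _ δK := fun κ' u' => by
    rw [SpureRecAt_zero_level]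
    exact (locStencil_add (locStencil_smul cE hW) (locStencil_smul cVH hV)) κ' u'
  exact ⟨_, _, _, _, δK, hδK, locStencil_unitS (sf := sf) (sm := sm) hS0, hE, hVH, decays_unitK (sf := sf) (sm := sm) hXd⟩

/-! ## §2 The face word of the FULL level-`0` table at the deep period, valued -/

/-- NOT IN PRINT; OUR BOOKKEEPING.  **leaf-02 PART 45's OUTPUT WORD FOR THE FULL LEVEL-`0` FINE TABLE AT PERIOD `Lc·N`, VALUED** (module docstring; `μ ≠ α`, `ν ≠ β`): the VH sector contributes
nothing, the E sector its `FaceWordEEValueZero` value. -/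
theorem faceWordFull_zero_value (hr : r ∈ box (d + 1) Lc) (sf sm cE cVH cΛ : ℝ) (N : ℕ) [NeZero N] {μ α ν β : Fin (d + 1)} (hμα : μ ≠ α) (hνβ : ν ≠ β) :
    ∑ rr ∈ box (d + 1) (Lc * N), ∑' t : Site (d + 1),
        (if toSite rr μ % ((Lc * N : ℕ) : ℤ) = ((Lc * N : ℕ) : ℤ) - 1 then (1 : ℝ) else 0) * (if t ν % ((Lc * N : ℕ) : ℤ) = ((Lc * N : ℕ) : ℤ) - 1 then (1 : ℝ) else 0) *
        ∑' yw : Site (d + 1) × Site (d + 1),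
          (if yw.1 α % ((Lc * N : ℕ) : ℤ) = ((Lc * N : ℕ) : ℤ) - 1 then (1 : ℝ) else 0) * (if yw.2 β % ((Lc * N : ℕ) : ℤ) = ((Lc * N : ℕ) : ℤ) - 1 then (1 : ℝ) else 0) *
          comp (comp (unitS sf sm (SpureRecAt d Lc (toSite r) cE cVH cΛ 0) μ (toSite rr))
            (unitK sf sm (coDressKBmAt (toSite r) Lc (KInvStep (d := d) Lc 0))))
            (unitS sf sm (SpureRecAt d Lc (toSite r) cE cVH cΛ 0) ν t)
            yw.1 yw.2 (Sum.inl α) (Sum.inl β) =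
      (((sf * sm)⁻¹ * (sf⁻¹ * sf⁻¹) * cE) * ((sf * sm)⁻¹ * (sf⁻¹ * sf⁻¹) * cE)) *
      ((-(1 / 2 : ℝ)) * (1 / 2 : ℝ) * ((sf * sf) *
        ((wVH d Lc 0)⁻¹ *
            ∑ x ∈ box (d + 1) (Lc * N), ∑ b : Fin (d + 1),
              ((if b = μ then ((((Lc * N : ℕ) : ℝ))⁻¹ * (((Lc * N : ℕ) : ℝ))⁻¹) * ((((toSite x α % ((Lc * N : ℕ) : ℤ) : ℤ) : ℝ) - ((((Lc * N : ℕ) : ℝ)) - 1) / 2)) else 0)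
                + (if b = α then (-(((Lc * N : ℕ) : ℝ))⁻¹ * ((((toSite x μ % ((Lc * N : ℕ) : ℤ) : ℤ) : ℝ) - ((((Lc * N : ℕ) : ℝ)) - 1) / 2))) *
                    (if toSite x α % ((Lc * N : ℕ) : ℤ) = ((Lc * N : ℕ) : ℤ) - 1 then (1 : ℝ) else 0) else 0)) *
              ∑' s : Site (d + 1), ∑ b' : Fin (d + 1), E2 d Lc 0 (toSite x) s (Sum.inl b) (Sum.inl b') *
                ((if b' = ν then ((((Lc * N : ℕ) : ℝ))⁻¹ * (((Lc * N : ℕ) : ℝ))⁻¹) * ((((s β % ((Lc * N : ℕ) : ℤ) : ℤ) : ℝ) - ((((Lc * N : ℕ) : ℝ)) - 1) / 2)) else 0)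
                  + (if b' = β then (-(((Lc * N : ℕ) : ℝ))⁻¹ * ((((s ν % ((Lc * N : ℕ) : ℤ) : ℤ) : ℝ) - ((((Lc * N : ℕ) : ℝ)) - 1) / 2))) *
                      (if s β % ((Lc * N : ℕ) : ℤ) = ((Lc * N : ℕ) : ℤ) - 1 then (1 : ℝ) else 0) else 0)) -
          (wVH d Lc 0)⁻¹ * (((Lc : ℝ) ^ (d + 1) * (Lc : ℝ) ^ (d + 1)) *
            ∑ y ∈ box (d + 1) N, ∑ a : Fin (d + 1),
              ((if a = μ then (((N : ℝ))⁻¹ * ((N : ℝ))⁻¹) * ((((toSite y α % (N : ℤ)) : ℤ) : ℝ) - ((N : ℝ) - 1) / 2) else 0)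
                + (if a = α then (-((N : ℝ))⁻¹ * ((((toSite y μ % (N : ℤ)) : ℤ) : ℝ) - ((N : ℝ) - 1) / 2)) *
                    (if toSite y α % (N : ℤ) = (N : ℤ) - 1 then (1 : ℝ) else 0) else 0)) *
              ∑' s : Site (d + 1), ∑ b' : Fin (d + 1), E2 d Lc 1 (toSite y) s (Sum.inl a) (Sum.inl b') *
                ((if b' = ν then (((N : ℝ))⁻¹ * ((N : ℝ))⁻¹) * ((((s β % (N : ℤ)) : ℤ) : ℝ) - ((N : ℝ) - 1) / 2) else 0)
                  + (if b' = β then (-((N : ℝ))⁻¹ * ((((s ν % (N : ℤ)) : ℤ) : ℝ) - ((N : ℝ) - 1) / 2)) *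
                      (if s β % (N : ℤ) = (N : ℤ) - 1 then (1 : ℝ) else 0) else 0)))))) := by
  have hLc : 1 ≤ Lc := one_le_of_neZero Lc
  haveI : NeZero (Lc * N) := ⟨Nat.mul_ne_zero (NeZero.ne Lc) (NeZero.ne N)⟩
  obtain ⟨Cs, Cs₁, Cs₂, CX, m, hm, hS, hS₁, hS₂, hX⟩ := exists_common_rate_full0 (d := d) hr sf sm cE cVH cΛ
  rw [faceWord_eq_cellPairing_of_null (N := Lc * N) hS hS₁ hS₂ hX hm
      (fun κ t s => by
        have h := fullTable0_translate (Lc := Lc) (r := r) sf sm cE cVH cΛ κ t ((N : ℤ) • s)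
        rwa [smul_smul, ← Nat.cast_mul] at h)
      (fun s => dressedStep_invariant_deep0 (Lc := Lc) (r := r) sf sm N s)
      (fun κ t => fullTable0_split (Lc := Lc) (r := r) sf sm cE cVH cΛ κ t)
      (fun κ t y x m' b => sectorE0_inr_left (d := d) sf sm cE κ t y x m' b)
      (fun κ t y x a m' => sectorE0_inr_right (d := d) sf sm cE κ t y x a m') μ ν α β
      (fun x f => vhSector_nullL (d := d) hLc hr N sf sm cVH μ α x f)
      (fun z g => vhSector_nullR (d := d) hLc hr N sf sm cVH ν β z g)]
  exact cellPairing_zero_value_units hr sf sm cE N hμα hνβ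

end Summit.QuantumFields.BalabanUV.Beta.GAN24.FaceWordFullZero

end
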